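import Mathlib
import Literature.Computability.Complexity.RangeAvoidance
import Literature.Computability.Complexity.SignDegreeXor
import Summits.PneNP.PneNP.Theorems.IP3ExpandingModel
import Summits.PneNP.PneNP.Theorems.IP3ExpandingCount
import Summits.PneNP.PneNP.Theorems.PstarExpandingExist
import Summits.PneNP.PneNP.Theorems.PstarIP3Law
import Summits.PneNP.PneNP.Theorems.QuotientSAHeadline

/-!
# Random pure `IP₃` instances, III: the estimate and the existence theorem (cell `pnp-ideate`, ROUND-22 item T22.2)

FRONTIER range-avoidance ladder, rung F-N3 context (restricted-model combinatorics — nothing here bears on `P` vs `NP`).  With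
`m = K·N` outputs on `N` variables the union bound of `IP3ExpandingCount.card_badSet6_le` is estimated term by term:

  `C(m,s)·C(N,v)·(64·v⁶/N⁶)^s ≤ (233280K/L)^s ≤ 2^{−s}`   for `v = v6 s = 5s − ⌈s/4⌉`, `5L⁴s ≤ N`, `L ≥ 466560K`

(`C(n,r) ≤ (3n/r)ʳ` from `PstarExpandingExist.choose_le`; the bookkeeping `s + v + ⌈s/4⌉ = 6s`; `N⁶ ≤ 64·|Fin 6 ↪ Fin N|` for
`N ≥ 10`).  Hence some outcome is good:

* `expandingIP3Exist` — for every `C` there is `c > 0` such that for every `N₀` some pure `IP₃` instance with `n ≥ N₀` inputs and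
  `m ≥ C·n` outputs (`n < m`) is `(n/c, 7/2)`-boundary expanding (`BoundaryExpandingQ 7 2 (n / c)`; `c = 5·(466560(C+2))⁴`);
* by name: `expandingIP3Exist' : QuotientSAHeadline.ExpandingIP3Exist` and `ip3PairwiseLaws' : QuotientSAHeadline.IP3PairwiseLaws`
  (from `PstarIP3Law`) — the two prover-1 inputs of COR-A `QuotientSAHeadline.ip3SALinearBlind_of`.
-/

set_option linter.dupNamespace false

open Finset Literature.Computability.Complexity
open Summit.PneNP.PneNP.Theorems.PstarSASDPLevel (BoundaryExpandingQ)
open Summit.PneNP.PneNP.Theorems.IP3ExpandingModel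
open Summit.PneNP.PneNP.Theorems.IP3ExpandingCount
open Summit.PneNP.PneNP.Theorems.PstarExpandingExist (choose_le geom_half_lt_one)

namespace Summit.PneNP.PneNP.Theorems.IP3ExpandingExist

/-- The exponent bookkeeping: with `a + b + q = 6a`,
`(3KN/s)^a · (3N/v)^b · (64v⁶/N⁶)^a = (192Kv/s)^a · 3^b · (v/N)^q`. -/
theorem key_identity6 (K N v s : ℝ) (hs : s ≠ 0) (hv : v ≠ 0) (hN : N ≠ 0) (a b q : ℕ) (h : a + b + q = 6 * a) :
    (3 * K * N / s) ^ a * (3 * N / v) ^ b * (64 * v ^ 6 / N ^ 6) ^ a =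
      (192 * K * v / s) ^ a * 3 ^ b * (v / N) ^ q := by
  have e1 : (64 * v ^ 6 / N ^ 6) ^ a = 64 ^ a * v ^ (a + b + q) / N ^ (a + b + q) := by
    rw [h, div_pow, mul_pow, ← pow_mul, ← pow_mul]
  rw [e1, show (192 : ℝ) = 3 * 64 by norm_num]
  simp only [pow_add, div_pow, mul_pow]
  field_simp

/-- **The term estimate.**  For `1 ≤ s`, `466560K ≤ L`, `5L⁴s ≤ N`, `m ≤ KN`:
`C(m,s)·C(N, v6 s)·(64·(v6 s)⁶/N⁶)^s ≤ 2^{−s}`. -/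
theorem term6_le (K L N s m : ℕ) (hs : 1 ≤ s) (hL : 466560 * K ≤ L) (hL1 : 1 ≤ L) (hN : 5 * L ^ 4 * s ≤ N)
    (hm : m ≤ K * N) :
    (m.choose s : ℝ) * (N.choose (v6 s) : ℝ) * (64 * ((v6 s : ℕ) : ℝ) ^ 6 / (N : ℝ) ^ 6) ^ s ≤ (1 / 2) ^ s := by
  set v := v6 s with hvdef
  set q := (s + 3) / 4 with hqdef
  have hvq : v + q = 5 * s := v6_add s
  have hq1 : 1 ≤ q := by omega
  have hqs : s ≤ 4 * q := by omega
  have hv1 : 1 ≤ v := by omega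
  have hv5 : v ≤ 5 * s := by omega
  have hL4 : 1 ≤ L ^ 4 := Nat.one_le_pow _ _ hL1
  have hN1 : 1 ≤ N := by nlinarith
  have hsR : (0 : ℝ) < s := by exact_mod_cast hs
  have hvR : (0 : ℝ) < v := by exact_mod_cast hv1
  have hNR : (0 : ℝ) < N := by exact_mod_cast hN1
  have hLR : (1 : ℝ) ≤ L := by exact_mod_cast hL1
  have hKR : (0 : ℝ) ≤ K := by positivity
  have hA : (m.choose s : ℝ) ≤ (3 * K * N / s) ^ s := by
    refine (choose_le m s hs).trans (pow_le_pow_left₀ (by positivity) ?_ _)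
    have : (m : ℝ) ≤ K * N := by exact_mod_cast hm
    rw [div_le_div_iff_of_pos_right hsR]
    linarith
  have hB : (N.choose v : ℝ) ≤ (3 * N / v) ^ v := choose_le N v hv1
  have hE : (m.choose s : ℝ) * (N.choose v : ℝ) * (64 * (v : ℝ) ^ 6 / (N : ℝ) ^ 6) ^ s ≤
      (3 * K * N / s) ^ s * (3 * N / v) ^ v * (64 * (v : ℝ) ^ 6 / (N : ℝ) ^ 6) ^ s := by
    have h0 : (0 : ℝ) ≤ (64 * (v : ℝ) ^ 6 / (N : ℝ) ^ 6) ^ s := by positivity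
    exact mul_le_mul_of_nonneg_right (mul_le_mul hA hB (by positivity) (by positivity)) h0
  rw [key_identity6 K N v s hsR.ne' hvR.ne' hNR.ne' s v q (by omega)] at hE
  refine hE.trans ?_
  have f1 : (192 * K * v / s : ℝ) ^ s ≤ (960 * K) ^ s := by
    refine pow_le_pow_left₀ (by positivity) ?_ _
    rw [div_le_iff₀ hsR]
    have : (v : ℝ) ≤ 5 * s := by exact_mod_cast hv5
    nlinarith
  have f2 : (3 : ℝ) ^ v ≤ 243 ^ s := by
    calc (3 : ℝ) ^ v ≤ 3 ^ (5 * s) := pow_le_pow_right₀ (by norm_num) hv5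
      _ = 243 ^ s := by rw [pow_mul]; norm_num
  have f3 : ((v : ℝ) / N) ^ q ≤ (1 / L) ^ s := by
    have h1 : (v : ℝ) / N ≤ 1 / L ^ 4 := by
      rw [div_le_div_iff₀ hNR (by positivity)]
      have : (5 * L ^ 4 * s : ℝ) ≤ N := by exact_mod_cast hN
      have : (v : ℝ) ≤ 5 * s := by exact_mod_cast hv5
      nlinarith
    calc ((v : ℝ) / N) ^ q ≤ (1 / L ^ 4) ^ q := pow_le_pow_left₀ (by positivity) h1 _
      _ = (1 / L) ^ (4 * q) := by rw [div_pow, div_pow, one_pow, one_pow, ← pow_mul]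
      _ ≤ (1 / L) ^ s := pow_le_pow_of_le_one (by positivity) (by
          rw [div_le_one (by positivity)]; exact hLR) hqs
  have hprod : (192 * K * v / s : ℝ) ^ s * 3 ^ v * ((v : ℝ) / N) ^ q ≤ (960 * K) ^ s * 243 ^ s * (1 / L) ^ s :=
    mul_le_mul (mul_le_mul f1 f2 (by positivity) (by positivity)) f3 (by positivity) (by positivity)
  refine hprod.trans ?_
  rw [← mul_pow, ← mul_pow]
  refine pow_le_pow_left₀ (by positivity) ?_ _
  have : (466560 * K : ℝ) ≤ L := by exact_mod_cast hL
  have hL0 : (0 : ℝ) < L := by linarith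
  rw [show (960 * K * 243 * (1 / L) : ℝ) = 233280 * K / L by field_simp; ring,
    div_le_div_iff₀ hL0 (by norm_num)]
  linarith

/-- `N⁶ ≤ 64·|Fin 6 ↪ Fin N|` for `N ≥ 10`. -/
theorem pow_six_le (N : ℕ) (hN : 10 ≤ N) : (N : ℝ) ^ 6 ≤ 64 * (Fintype.card (Fin 6 ↪ Fin N) : ℝ) := by
  rw [Fintype.card_embedding_eq, Fintype.card_fin, Fintype.card_fin]
  have h1 : (N + 1 - 6) ^ 6 ≤ N.descFactorial 6 := Nat.pow_sub_le_descFactorial N 6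
  have h2 : ((N + 1 - 6 : ℕ) : ℝ) = (N : ℝ) - 5 := by
    rw [Nat.cast_sub (by omega)]; push_cast; ring
  have h3 : ((N : ℝ) - 5) ^ 6 ≤ (N.descFactorial 6 : ℝ) := by
    rw [← h2]; exact_mod_cast h1
  have hN' : (10 : ℝ) ≤ N := by exact_mod_cast hN
  have h4 : (N : ℝ) / 2 ≤ (N : ℝ) - 5 := by linarith
  have h5 : ((N : ℝ) / 2) ^ 6 ≤ ((N : ℝ) - 5) ^ 6 := pow_le_pow_left₀ (by positivity) h4 6
  have h6 : ((N : ℝ) / 2) ^ 6 = (N : ℝ) ^ 6 / 64 := by rw [div_pow]; norm_num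
  rw [h6] at h5
  have := h5.trans h3
  rw [div_le_iff₀ (by norm_num : (0:ℝ) < 64)] at this
  linarith

/-- **Good outcomes exist**: with `L ≥ 466560K`, `N ≥ 10`, `m ≤ KN`, `r = N/(5L⁴)`, fewer outcomes are bad than there are. -/
theorem card_badSet6_lt (K L N m : ℕ) (hL : 466560 * K ≤ L) (hL1 : 1 ≤ L) (hN : 10 ≤ N) (hm : m ≤ K * N) :
    ((badSet6 N m (N / (5 * L ^ 4))).card : ℝ) < (Fintype.card (Outcome6 N m) : ℝ) := by
  set r := N / (5 * L ^ 4) with hr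
  have hL4 : 1 ≤ L ^ 4 := Nat.one_le_pow _ _ hL1
  have hr5 : 5 * r ≤ N := by
    have := Nat.div_mul_le_self N (5 * L ^ 4)
    nlinarith
  set Q : ℕ := Fintype.card (Fin 6 ↪ Fin N) with hQ
  have hcardΩ : Fintype.card (Outcome6 N m) = Q ^ m := by
    rw [Fintype.card_fun, Fintype.card_fin]
  have hQ64 : (N : ℝ) ^ 6 ≤ 64 * (Q : ℝ) := pow_six_le N hN
  have hNR : (0 : ℝ) < N := by exact_mod_cast (show 0 < N by omega)
  have hQpos : (0 : ℝ) < Q := by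
    have : (0 : ℝ) < (N : ℝ) ^ 6 := by positivity
    linarith
  have hub := card_badSet6_le (m := m) r hr5
  refine lt_of_le_of_lt hub ?_
  rw [hcardΩ]
  push_cast
  have hterm : ∀ i ∈ Finset.range r,
      (m.choose (i + 1) : ℝ) * (N.choose (v6 (i + 1)) : ℝ) * ((((v6 (i + 1) : ℕ) : ℝ) ^ 6) ^ (i + 1)) *
          (Q : ℝ) ^ (m - (i + 1)) ≤ (1 / 2) ^ (i + 1) * (Q : ℝ) ^ m := by
    intro i hi
    rw [Finset.mem_range] at hi
    have hs : 5 * L ^ 4 * (i + 1) ≤ N := by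
      calc 5 * L ^ 4 * (i + 1) ≤ 5 * L ^ 4 * r := Nat.mul_le_mul_left _ hi
        _ ≤ N := by rw [hr, Nat.mul_comm]; exact Nat.div_mul_le_self N (5 * L ^ 4)
    have hsm : i + 1 ≤ m ∨ m < i + 1 := le_or_gt _ _
    have ht := term6_le K L N (i + 1) m (by omega) hL hL1 hs hm
    rcases hsm with hsm | hsm
    · have hQsplit : (Q : ℝ) ^ m = (Q : ℝ) ^ (i + 1) * (Q : ℝ) ^ (m - (i + 1)) := by
        rw [← pow_add]; congr 1; omega
      rw [hQsplit]
      have hstep : ((((v6 (i + 1) : ℕ) : ℝ) ^ 6) ^ (i + 1)) ≤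
          (64 * ((v6 (i + 1) : ℕ) : ℝ) ^ 6 / (N : ℝ) ^ 6) ^ (i + 1) * (Q : ℝ) ^ (i + 1) := by
        rw [← mul_pow]
        refine pow_le_pow_left₀ (by positivity) ?_ _
        rw [div_mul_eq_mul_div, le_div_iff₀ (by positivity)]
        have h0 : (0 : ℝ) ≤ ((v6 (i + 1) : ℕ) : ℝ) ^ 6 := by positivity
        nlinarith
      have hQm : (0 : ℝ) ≤ (Q : ℝ) ^ (m - (i + 1)) := by positivity
      have hcc : (0 : ℝ) ≤ (m.choose (i + 1) : ℝ) * (N.choose (v6 (i + 1)) : ℝ) := by positivity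
      calc (m.choose (i + 1) : ℝ) * (N.choose (v6 (i + 1)) : ℝ) * (((v6 (i + 1) : ℕ) : ℝ) ^ 6) ^ (i + 1) *
            (Q : ℝ) ^ (m - (i + 1))
          ≤ (m.choose (i + 1) : ℝ) * (N.choose (v6 (i + 1)) : ℝ) *
            ((64 * ((v6 (i + 1) : ℕ) : ℝ) ^ 6 / (N : ℝ) ^ 6) ^ (i + 1) * (Q : ℝ) ^ (i + 1)) *
              (Q : ℝ) ^ (m - (i + 1)) :=
            mul_le_mul_of_nonneg_right (mul_le_mul_of_nonneg_left hstep hcc) hQm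
        _ = ((m.choose (i + 1) : ℝ) * (N.choose (v6 (i + 1)) : ℝ) *
            (64 * ((v6 (i + 1) : ℕ) : ℝ) ^ 6 / (N : ℝ) ^ 6) ^ (i + 1)) *
              ((Q : ℝ) ^ (i + 1) * (Q : ℝ) ^ (m - (i + 1))) := by ring
        _ ≤ (1 / 2) ^ (i + 1) * ((Q : ℝ) ^ (i + 1) * (Q : ℝ) ^ (m - (i + 1))) :=
            mul_le_mul_of_nonneg_right ht (by positivity)
    · rw [Nat.choose_eq_zero_of_lt hsm]
      simp only [Nat.cast_zero, zero_mul]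
      positivity
  refine (Finset.sum_le_sum hterm).trans_lt ?_
  rw [← Finset.sum_mul]
  have hQm : (0 : ℝ) < (Q : ℝ) ^ m := by positivity
  calc (∑ i ∈ Finset.range r, (1 / 2 : ℝ) ^ (i + 1)) * (Q : ℝ) ^ m < 1 * (Q : ℝ) ^ m :=
        mul_lt_mul_of_pos_right (geom_half_lt_one r) hQm
    _ = (Q : ℝ) ^ m := one_mul _

/-- **A good outcome exists.** -/
theorem exists_good6 (K L N m : ℕ) (hL : 466560 * K ≤ L) (hL1 : 1 ≤ L) (hN : 10 ≤ N) (hm : m ≤ K * N) :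
    ∃ ω : Outcome6 N m, ¬bad6 (N / (5 * L ^ 4)) ω := by
  classical
  by_contra h
  push Not at h
  have hall : badSet6 N m (N / (5 * L ^ 4)) = univ := by
    ext ω; simp [badSet6, h ω]
  have := card_badSet6_lt K L N m hL hL1 hN hm
  rw [hall, Finset.card_univ] at this
  exact lt_irrefl _ this

/-- **T22.2 — boundary-expanding pure `IP₃` instances exist at every linear stretch** (ratio `7/2`, first-moment counting):
`∀ C, ∃ c > 0, ∀ N₀, ∃ n ≥ N₀, ∃ m, n < m ∧ C·n ≤ m ∧ ∃ I : LocalMap 6 n m, I.IsPure (ipPred 3) ∧ BoundaryExpandingQ 7 2 (n / c) I`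
(`c = 5·(466560(C+2))⁴`). -/
theorem expandingIP3Exist : ∀ C : ℕ, ∃ c : ℕ, 0 < c ∧ ∀ N₀ : ℕ, ∃ n, N₀ ≤ n ∧ ∃ m, n < m ∧ C * n ≤ m ∧
    ∃ I : LocalMap 6 n m, I.IsPure (ipPred 3) ∧ BoundaryExpandingQ 7 2 (n / c) I := by
  intro C
  set K := C + 2 with hK
  set L := 466560 * K with hLdef
  have hL1 : 1 ≤ L := by omega
  refine ⟨5 * L ^ 4, by positivity, fun N₀ => ?_⟩
  set N := max N₀ 10 with hNdef
  have hN10 : 10 ≤ N := le_max_right _ _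
  have hN0 : N₀ ≤ N := le_max_left _ _
  obtain ⟨ω, hω⟩ := exists_good6 K L N (K * N) le_rfl hL1 hN10 le_rfl
  exact ⟨N, hN0, K * N, by nlinarith, by nlinarith, inst6 ω, isPure_inst6 ω, boundaryExpandingQ_of_not_bad6 _ ω hω⟩

/-! ## The two inputs of COR-A by name -/

/-- **`QuotientSAHeadline.ExpandingIP3Exist` holds** (T22.2). -/
theorem expandingIP3Exist' : QuotientSAHeadline.ExpandingIP3Exist := expandingIP3Exist

/-- **`QuotientSAHeadline.IP3PairwiseLaws` holds** (T22.1a(i), `PstarIP3Law.ip3PairwiseLaws`). -/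
theorem ip3PairwiseLaws' : QuotientSAHeadline.IP3PairwiseLaws := PstarIP3Law.ip3PairwiseLaws

end Summit.PneNP.PneNP.Theorems.IP3ExpandingExist
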